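import Mathlib
import Literature.Probability.LatticeModels.LatticeGraph
import Literature.MathematicalPhysics.QuantumLattice.ApproximateEigenvectorLemmas
import Summits.HubbardSuperconductivity.HubbardSuperconductivity.Theorems.WcbcsSsbToTorusLRO.Negative.BlockRepulsionDominatesPairOrder

/-!
# Crux `CwSsbToEvenTorusLRO` (stmt-HubbardSuperconductivity-10439, route `ChiralWindow`), line
`kac-stiffness-poincare-closure` — stub `stub_torusPoincare` (S1, the vector-valued discrete Poincaré
inequality on the 2-torus)

For every `L ≥ 1`, every finite index type `m` and every family of vectors `v_x ∈ ℂ^m` indexed by the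
sites `x` of the discrete torus `(ℤ/Lℤ)²` (`TorusSite 2 L = Fin 2 → ZMod L`):

`L² Σ_x ‖v_x‖² − L⁴ Σ_x Σ_i ‖v_{x+eᵢ} − v_x‖² ≤ ‖Σ_x v_x‖²`,

where `‖w‖² = Re (w⋆ · w)` and `eᵢ = Pi.single i 1`. This is a (deliberately crude) vector-valued discrete
Poincaré inequality; the lead's skeleton instantiates it with `v_x := B_x ψ` (Kac block pair operators applied
to a state) to get `lro(ψ) ≥ BC_R(ψ) − Q_R(ψ)`.

Proof (elementary, no Fourier analysis):

* pair identity `Σ_x Σ_y ‖v_x − v_y‖² = 2 L² Σ_x ‖v_x‖² − 2 ‖Σ_x v_x‖²` (expand the inner products,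
  `|(ℤ/L)²| = L²`);
* path bound: in coordinates `x = (s, t)`, `y = (s', t')` go from `y` to `x` first along the first coordinate,
  then along the second; each leg telescopes into at most `L` nearest-neighbour differences on a cycle
  `ℤ/L`, so by Cauchy–Schwarz `‖leg‖² ≤ L · (sum of ALL squared nearest-neighbour differences on that cycle)`;
  with `‖a + b‖² ≤ 2‖a‖² + 2‖b‖²` and summing over the `L⁴` pairs, `Σ_x Σ_y ‖v_x − v_y‖² ≤ 2 L⁴ Σ_x Σ_i
  ‖v_{x+eᵢ} − v_x‖²`;
* combine and divide by two.

The sharp constant (`L²/(4 sin²(π/L))` in place of `L⁴`) is not needed downstream. No definition is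
introduced; the helper lemmas are private. [folklore]
-/

noncomputable section

-- D-0017: single-problem summit, so the namespace `Summit.HubbardSuperconductivity.HubbardSuperconductivity.…`
-- repeats a segment by design (the lakefile sets the same option for the whole `Summits` library).
set_option linter.dupNamespace false

namespace Summit.HubbardSuperconductivity.HubbardSuperconductivity.Theorems.CwSsbToEvenTorusLRO

open Literature.MathematicalPhysics.QuantumLattice Matrix
open Summit.HubbardSuperconductivity.WcbcsSsbToTorusLRO.Negative (re_star_sum_dotProduct_sum_le)
open scoped Matrix ComplexOrder

section Abstract

variable {m : Type*} [Fintype m]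

/-- `‖a + b‖² ≤ 2‖a‖² + 2‖b‖²` for the Euclidean norm on `m → ℂ`, written with `‖w‖² = Re (w⋆ · w)`.
[folklore] -/
private theorem re_star_add_dotProduct_add_le (a b : m → ℂ) :
    (star (a + b) ⬝ᵥ (a + b)).re ≤ 2 * (star a ⬝ᵥ a).re + 2 * (star b ⬝ᵥ b).re := by
  rw [← eucNorm_sq, ← eucNorm_sq, ← eucNorm_sq]
  have h1 : eucNorm (a + b) ^ 2 ≤ (eucNorm a + eucNorm b) ^ 2 :=
    pow_le_pow_left₀ (eucNorm_nonneg _) (eucNorm_add_le a b) 2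
  nlinarith [sq_nonneg (eucNorm a - eucNorm b)]

/-- `0 ≤ ‖w‖² = Re (w⋆ · w)`. [folklore] -/
private theorem re_star_dotProduct_self_nonneg (w : m → ℂ) : 0 ≤ (star w ⬝ᵥ w).re := by
  rw [← eucNorm_sq]; exact sq_nonneg _

/-- One-dimensional path bound on the cycle `ℤ/L`: for `f : ℤ/L → ℂ^m` and any two points `a, b`,
`‖f b − f a‖² ≤ L · Σ_r ‖f (r+1) − f r‖²` (telescope along `a, a+1, …, b`, Cauchy–Schwarz, and enlarge the
at most `L` steps to the whole cycle). [folklore] -/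
private theorem re_star_sub_dotProduct_sub_le_cycle (L : ℕ) [NeZero L] (f : ZMod L → m → ℂ)
    (a b : ZMod L) :
    (star (f b - f a) ⬝ᵥ (f b - f a)).re ≤
      (L : ℝ) * ∑ r : ZMod L, (star (f (r + 1) - f r) ⬝ᵥ (f (r + 1) - f r)).re := by
  obtain ⟨d, hdL, rfl⟩ : ∃ d : ℕ, d < L ∧ b = a + (d : ZMod L) :=
    ⟨(b - a).val, ZMod.val_lt _, by rw [ZMod.natCast_zmod_val, add_sub_cancel]⟩
  -- telescoping along the path `a, a + 1, …, a + d`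
  have htel : f (a + (d : ZMod L)) - f a =
      ∑ j ∈ Finset.range d, (f (a + (j : ZMod L) + 1) - f (a + (j : ZMod L))) := by
    have h := Finset.sum_range_sub (fun j : ℕ => f (a + (j : ZMod L))) d
    simp only [Nat.cast_add, Nat.cast_one, Nat.cast_zero, add_zero, ← add_assoc] at h
    exact h.symm
  -- Cauchy–Schwarz over the `d` steps
  have hcs := re_star_sum_dotProduct_sum_le (Finset.range d)
    (fun j : ℕ => f (a + (j : ZMod L) + 1) - f (a + (j : ZMod L)))
  rw [Finset.card_range] at hcs
  -- enlarge to all `L` steps and reindex by the cycle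
  have hsub : ∑ j ∈ Finset.range d,
      (star (f (a + (j : ZMod L) + 1) - f (a + (j : ZMod L))) ⬝ᵥ
        (f (a + (j : ZMod L) + 1) - f (a + (j : ZMod L)))).re ≤
      ∑ j ∈ Finset.range L,
      (star (f (a + (j : ZMod L) + 1) - f (a + (j : ZMod L))) ⬝ᵥ
        (f (a + (j : ZMod L) + 1) - f (a + (j : ZMod L)))).re :=
    Finset.sum_le_sum_of_subset_of_nonneg (Finset.range_subset_range.2 hdL.le)
      (fun j _ _ => re_star_dotProduct_self_nonneg _)
  have hre : ∑ j ∈ Finset.range L,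
      (star (f (a + (j : ZMod L) + 1) - f (a + (j : ZMod L))) ⬝ᵥ
        (f (a + (j : ZMod L) + 1) - f (a + (j : ZMod L)))).re =
      ∑ r : ZMod L, (star (f (r + 1) - f r) ⬝ᵥ (f (r + 1) - f r)).re := by
    refine Finset.sum_nbij' (fun j : ℕ => a + (j : ZMod L)) (fun r : ZMod L => (r - a).val)
      (fun _ _ => Finset.mem_univ _) (fun r _ => Finset.mem_range.2 (ZMod.val_lt _))
      (fun j hj => ?_) (fun r _ => ?_) (fun _ _ => rfl)
    · simp only [add_sub_cancel_left, ZMod.val_natCast]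
      exact Nat.mod_eq_of_lt (Finset.mem_range.1 hj)
    · simp only [ZMod.natCast_zmod_val, add_sub_cancel]
  calc (star (f (a + (d : ZMod L)) - f a) ⬝ᵥ (f (a + (d : ZMod L)) - f a)).re
      ≤ (d : ℝ) * ∑ j ∈ Finset.range d,
          (star (f (a + (j : ZMod L) + 1) - f (a + (j : ZMod L))) ⬝ᵥ
            (f (a + (j : ZMod L) + 1) - f (a + (j : ZMod L)))).re := by rw [htel]; exact hcs
    _ ≤ (L : ℝ) * ∑ j ∈ Finset.range L,
          (star (f (a + (j : ZMod L) + 1) - f (a + (j : ZMod L))) ⬝ᵥ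
            (f (a + (j : ZMod L) + 1) - f (a + (j : ZMod L)))).re :=
        mul_le_mul (Nat.cast_le.2 hdL.le) hsub
          (Finset.sum_nonneg fun j _ => re_star_dotProduct_self_nonneg _) (Nat.cast_nonneg _)
    _ = (L : ℝ) * ∑ r : ZMod L, (star (f (r + 1) - f r) ⬝ᵥ (f (r + 1) - f r)).re := by rw [hre]

/-- Two-dimensional pair bound in coordinates: for `u : ℤ/L → ℤ/L → ℂ^m`,
`Σ_{s,t,s',t'} ‖u s t − u s' t'‖² ≤ 2 L⁴ (Σ_{s,t} ‖u (s+1) t − u s t‖² + Σ_{s,t} ‖u s (t+1) − u s t‖²)`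
(go from `(s', t')` to `(s, t)` through `(s', t)`; each leg is bounded by the cycle bound, and each cycle
sum is counted `L³` times). [folklore] -/
private theorem sum_pair_le_torus (L : ℕ) [NeZero L] (u : ZMod L → ZMod L → m → ℂ) :
    ∑ s : ZMod L, ∑ t : ZMod L, ∑ s' : ZMod L, ∑ t' : ZMod L,
        (star (u s t - u s' t') ⬝ᵥ (u s t - u s' t')).re ≤
      2 * (L : ℝ) ^ 4 *
        ((∑ s : ZMod L, ∑ t : ZMod L, (star (u (s + 1) t - u s t) ⬝ᵥ (u (s + 1) t - u s t)).re) +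
          ∑ s : ZMod L, ∑ t : ZMod L, (star (u s (t + 1) - u s t) ⬝ᵥ (u s (t + 1) - u s t)).re) := by
  have key : ∀ s t s' t' : ZMod L,
      (star (u s t - u s' t') ⬝ᵥ (u s t - u s' t')).re ≤
        2 * ((L : ℝ) * ∑ r : ZMod L, (star (u (r + 1) t - u r t) ⬝ᵥ (u (r + 1) t - u r t)).re) +
          2 * ((L : ℝ) * ∑ r : ZMod L,
            (star (u s' (r + 1) - u s' r) ⬝ᵥ (u s' (r + 1) - u s' r)).re) := by
    intro s t s' t'
    have hsplit : u s t - u s' t' = (u s t - u s' t) + (u s' t - u s' t') := by abel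
    have h0 := re_star_sub_dotProduct_sub_le_cycle L (fun r => u r t) s' s
    have h1 := re_star_sub_dotProduct_sub_le_cycle L (u s') t' t
    rw [hsplit]
    refine (re_star_add_dotProduct_add_le _ _).trans ?_
    gcongr
  refine (Finset.sum_le_sum fun s _ => Finset.sum_le_sum fun t _ => Finset.sum_le_sum fun s' _ =>
    Finset.sum_le_sum fun t' _ => key s t s' t').trans_eq ?_
  simp only [Finset.sum_add_distrib, Finset.sum_const, Finset.card_univ, ZMod.card, nsmul_eq_mul,
    ← Finset.mul_sum]
  rw [Finset.sum_comm (f := fun (t : ZMod L) (r : ZMod L) =>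
    (star (u (r + 1) t - u r t) ⬝ᵥ (u (r + 1) t - u r t)).re)]
  ring

end Abstract

/-- **Stub S1 — vector-valued discrete Poincaré inequality on the 2-torus (finite `L`).** For any family of
vectors `v_x ∈ ℂ^m` indexed by the sites `x` of `(ℤ/Lℤ)²`:
`L² Σ_x ‖v_x‖² − L⁴ Σ_x Σ_i ‖v_{x+eᵢ} − v_x‖² ≤ ‖Σ_x v_x‖²` (`‖w‖² = Re (w⋆ · w)`).
Proof: pair identity `Σ_{x,y} ‖v_x − v_y‖² = 2L² Σ_x ‖v_x‖² − 2‖Σ_x v_x‖²` and the crude path bound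
`Σ_{x,y} ‖v_x − v_y‖² ≤ 2L⁴ Σ_x Σ_i ‖v_{x+eᵢ} − v_x‖²`. [folklore] -/
theorem stub_torusPoincare :
    ∀ (L : ℕ) [NeZero L] (m : Type) [Fintype m]
      (v : Literature.Probability.LatticeModels.TorusSite 2 L → m → ℂ),
      (L : ℝ) ^ 2 * (∑ x : Literature.Probability.LatticeModels.TorusSite 2 L, (star (v x) ⬝ᵥ v x).re) -
          (L : ℝ) ^ 4 * (∑ x : Literature.Probability.LatticeModels.TorusSite 2 L, ∑ i : Fin 2,
            (star (v (x + Pi.single i 1) - v x) ⬝ᵥ (v (x + Pi.single i 1) - v x)).re) ≤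
        (star (∑ x : Literature.Probability.LatticeModels.TorusSite 2 L, v x) ⬝ᵥ
          (∑ x : Literature.Probability.LatticeModels.TorusSite 2 L, v x)).re := by
  intro L _ m _ v
  -- (1) the pair identity
  have hexp : ∀ x y : Literature.Probability.LatticeModels.TorusSite 2 L,
      (star (v x - v y) ⬝ᵥ (v x - v y)).re =
        (star (v x) ⬝ᵥ v x).re + (star (v y) ⬝ᵥ v y).re -
          ((star (v x) ⬝ᵥ v y).re + (star (v y) ⬝ᵥ v x).re) := by
    intro x y
    rw [star_sub, sub_dotProduct, dotProduct_sub, dotProduct_sub, Complex.sub_re, Complex.sub_re,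
      Complex.sub_re]
    ring
  have hcross : (star (∑ x : Literature.Probability.LatticeModels.TorusSite 2 L, v x) ⬝ᵥ
      (∑ x : Literature.Probability.LatticeModels.TorusSite 2 L, v x)).re =
      ∑ x : Literature.Probability.LatticeModels.TorusSite 2 L,
        ∑ y : Literature.Probability.LatticeModels.TorusSite 2 L, (star (v x) ⬝ᵥ v y).re := by
    rw [star_sum, sum_dotProduct, Complex.re_sum]
    refine Finset.sum_congr rfl fun x _ => ?_
    rw [dotProduct_sum, Complex.re_sum]
  have hcross' : ∑ x : Literature.Probability.LatticeModels.TorusSite 2 L,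
      ∑ y : Literature.Probability.LatticeModels.TorusSite 2 L, (star (v y) ⬝ᵥ v x).re =
      (star (∑ x : Literature.Probability.LatticeModels.TorusSite 2 L, v x) ⬝ᵥ
        (∑ x : Literature.Probability.LatticeModels.TorusSite 2 L, v x)).re := by
    rw [Finset.sum_comm]; exact hcross.symm
  have hpair : ∑ x : Literature.Probability.LatticeModels.TorusSite 2 L,
      ∑ y : Literature.Probability.LatticeModels.TorusSite 2 L, (star (v x - v y) ⬝ᵥ (v x - v y)).re =
      2 * ((L : ℝ) ^ 2 * ∑ x : Literature.Probability.LatticeModels.TorusSite 2 L, (star (v x) ⬝ᵥ v x).re) -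
        2 * (star (∑ x : Literature.Probability.LatticeModels.TorusSite 2 L, v x) ⬝ᵥ
          (∑ x : Literature.Probability.LatticeModels.TorusSite 2 L, v x)).re := by
    simp only [hexp, Finset.sum_sub_distrib, Finset.sum_add_distrib, Finset.sum_const, Finset.card_univ,
      card_torusSite_two, nsmul_eq_mul, Nat.cast_pow, ← Finset.mul_sum]
    rw [hcross', ← hcross]
    ring
  -- (2) coordinates `x = ![s, t]`
  have hsum : ∀ F : Literature.Probability.LatticeModels.TorusSite 2 L → ℝ,
      ∑ x, F x = ∑ s : ZMod L, ∑ t : ZMod L, F ![s, t] := by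
    intro F
    have h := Fintype.sum_equiv (finTwoArrowEquiv (ZMod L)).symm (fun p => F ![p.1, p.2]) F
      (fun _ => rfl)
    rw [Fintype.sum_prod_type] at h
    exact h.symm
  have e0 : ∀ s t : ZMod L, (![s, t] : Fin 2 → ZMod L) + Pi.single 0 1 = ![s + 1, t] := by
    intro s t; ext i; fin_cases i <;> simp
  have e1 : ∀ s t : ZMod L, (![s, t] : Fin 2 → ZMod L) + Pi.single 1 1 = ![s, t + 1] := by
    intro s t; ext i; fin_cases i <;> simp
  have hGconv : (∑ x : Literature.Probability.LatticeModels.TorusSite 2 L, ∑ i : Fin 2,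
      (star (v (x + Pi.single i 1) - v x) ⬝ᵥ (v (x + Pi.single i 1) - v x)).re) =
      (∑ s : ZMod L, ∑ t : ZMod L,
          (star (v ![s + 1, t] - v ![s, t]) ⬝ᵥ (v ![s + 1, t] - v ![s, t])).re) +
        ∑ s : ZMod L, ∑ t : ZMod L,
          (star (v ![s, t + 1] - v ![s, t]) ⬝ᵥ (v ![s, t + 1] - v ![s, t])).re := by
    rw [hsum]
    simp only [Fin.sum_univ_two, e0, e1, Finset.sum_add_distrib]
  have hPconv : ∑ x : Literature.Probability.LatticeModels.TorusSite 2 L,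
      ∑ y : Literature.Probability.LatticeModels.TorusSite 2 L, (star (v x - v y) ⬝ᵥ (v x - v y)).re =
      ∑ s : ZMod L, ∑ t : ZMod L, ∑ s' : ZMod L, ∑ t' : ZMod L,
        (star (v ![s, t] - v ![s', t']) ⬝ᵥ (v ![s, t] - v ![s', t'])).re := by
    rw [hsum]
    simp only [hsum]
  -- (3)+(4) the path bound, summed
  have hG := sum_pair_le_torus L (fun s t => v ![s, t])
  rw [hGconv]
  linarith [hpair, hPconv, hG]

end Summit.HubbardSuperconductivity.HubbardSuperconductivity.Theorems.CwSsbToEvenTorusLRO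

end
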